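import Literature.NumberTheory.LFunctions.WeilCombNodeWeightsSums
import Literature.NumberTheory.LFunctions.MontgomeryOffDiagonalTools
import HarnessLib

/-!
# Node weights of `ζ`-mollified combs, IX: the node sum of one pair against `c - Λ`

Topic `Literature/NumberTheory/LFunctions`.  For a nonnegative weight `c` with Chebyshev bound
`∑_{n ≤ N} c(n) ≤ A₁N` whose logarithmic sums stay within `T₀` of those of `Λ`
(`|∑_{n ≤ N} (c(n) - Λ(n))/n| ≤ T₀` for all `N`), the node sums of one pair `(ℓ, ℓ')` of a
`ζ`-mollified comb against `c` and against `Λ` differ by the DIAGONAL difference plus `O(log)`: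

* `pair_difference_bound` —
  `|E_c - E_Λ - B(0)(√ℓ/√ℓ') ∑_{n ≤ N} ((c - Λ)(n)/n) D(n)|`
  `≤ C₃ (A₁ + A_Λ)(1 + log N) + 8N₀L h (A₁ + A_Λ) N + 8N₀L h M ((2T₀ + 3A')L + T₀ + A')`,
  `E_f = ∑_{n ≤ N} f(n) V_{ℓℓ'}(n)`, `A_Λ = log 4 + 4` (Chebyshev for `Λ`,
  `Literature.NumberTheory.LFunctions.Montgomery.sum_Icc_vonMangoldt_le`), `A' = A₁ + A_Λ`,
  `C₃ = 8C₂L + 64N₀L²`: the smooth main terms cancel up to `O(hM) = O(κ)` by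
  `Literature/NumberTheory/LFunctions/WeilCombDifferenceSums.lean`.

Everything is proved; no named facts.
-/

noncomputable section

open MeasureTheory Set
open scoped ArithmeticFunction.vonMangoldt

namespace Literature.NumberTheory.LFunctions

/-- `∑_{n ≤ N} |c(n) - Λ(n)| ≤ (A₁ + log 4 + 4) N` for `c ≥ 0` with `∑_{n ≤ N} c(n) ≤ A₁ N`.
[folklore] -/
theorem sum_abs_sub_vonMangoldt_le {c : ℕ → ℝ} {A₁ : ℝ} (hc0 : ∀ n, 0 ≤ c n)
    (hA₁ : ∀ N : ℕ, 1 ≤ N → ∑ n ∈ Finset.Icc 1 N, c n ≤ A₁ * N) (N : ℕ) :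
    ∑ n ∈ Finset.Icc 1 N, |c n - Λ n| ≤ (A₁ + (Real.log 4 + 4)) * N := by
  rcases Nat.eq_zero_or_pos N with hN | hN
  · subst hN; simp
  calc ∑ n ∈ Finset.Icc 1 N, |c n - Λ n| ≤ ∑ n ∈ Finset.Icc 1 N, (c n + Λ n) := by
        refine Finset.sum_le_sum fun n _ ↦ ?_
        have h1 := hc0 n
        have h2 : (0 : ℝ) ≤ Λ n := ArithmeticFunction.vonMangoldt_nonneg
        rw [abs_le]; constructor <;> linarith
    _ = ∑ n ∈ Finset.Icc 1 N, c n + ∑ n ∈ Finset.Icc 1 N, (Λ n : ℝ) := Finset.sum_add_distrib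
    _ ≤ A₁ * N + (Real.log 4 + 4) * N := add_le_add (hA₁ N hN) (Montgomery.sum_Icc_vonMangoldt_le N)
    _ = (A₁ + (Real.log 4 + 4)) * N := by ring

/-- **The node sum of one pair against `c - Λ`.** Under the hypotheses of `weighted_node_pair`,
for `c ≥ 0` with `∑_{n ≤ N} c(n) ≤ A₁N` and `|∑_{n ≤ N} (c(n) - Λ(n))/n| ≤ T₀` (all `N`):
`|∑_n c(n)V(n) - ∑_n Λ(n)V(n) - B(0)(√ℓ/√ℓ') ∑_n ((c(n) - Λ(n))/n) D(n)|`
`≤ C₃(A₁ + A_Λ)(1 + log N) + 8N₀Lh(A₁ + A_Λ)N + 8N₀LhM((2T₀ + 3A')L + T₀ + A')`. [folklore] -/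
theorem pair_difference_bound {B B' B'' : ℝ → ℝ} {N₀ N₁ N₂ h A₁ T₀ : ℝ} {L ℓ ℓ' M N : ℕ}
    {c : ℕ → ℝ}
    (hB : ∀ x, HasDerivAt B (B' x) x) (hB' : ∀ x, HasDerivAt B' (B'' x) x)
    (h0 : ∀ x, |B x| ≤ N₀) (h1 : ∀ x, |B' x| ≤ N₁) (h2 : ∀ x, |B'' x| ≤ N₂)
    (hBs : ∀ x, 2 < |x| → B x = 0) (hB0 : ∀ x, 0 ≤ B x)
    (hL : 1 ≤ L) (hℓ : 1 ≤ ℓ) (hℓL : ℓ ≤ L) (hℓ' : 1 ≤ ℓ') (hℓ'L : ℓ' ≤ L)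
    (hh : 0 < h) (hhL : h ≤ 1 / (32 * L)) (hhM : 1 ≤ h * M) (hhM2 : h ^ 2 * M ≤ 1)
    (hc0 : ∀ n, 0 ≤ c n) (hA₁ : ∀ N : ℕ, 1 ≤ N → ∑ n ∈ Finset.Icc 1 N, c n ≤ A₁ * N)
    (hT : ∀ N : ℕ, |∑ n ∈ Finset.Icc 1 N, (c n - Λ n) / n| ≤ T₀) (hN : 1 ≤ N) :
    |∑ n ∈ Finset.Icc 1 N, c n *
        (∑ k' ∈ Finset.Icc 1 M,
          (∑ k ∈ Finset.Icc 1 M, B ((Real.log ((n : ℝ) * ℓ' * k' / ℓ) - Real.log k) / h) / Real.sqrt k)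
            / Real.sqrt k' / Real.sqrt n)
      - ∑ n ∈ Finset.Icc 1 N, (Λ n : ℝ) *
        (∑ k' ∈ Finset.Icc 1 M,
          (∑ k ∈ Finset.Icc 1 M, B ((Real.log ((n : ℝ) * ℓ' * k' / ℓ) - Real.log k) / h) / Real.sqrt k)
            / Real.sqrt k' / Real.sqrt n)
      - B 0 * (Real.sqrt ℓ / Real.sqrt ℓ') * ∑ n ∈ Finset.Icc 1 N,
          (c n - Λ n) / n * (∑ k' ∈ Finset.Icc 1 ⌊1 / (4 * h) / ((n : ℝ) * ℓ')⌋₊,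
            (if ℓ ∣ n * ℓ' * k' then 1 / (k' : ℝ) else 0))|
      ≤ (8 * ((N₀ + 2 * N₁ + N₂) * (96 + 192 * L) * L ^ 2) * L + 64 * N₀ * L ^ 2) *
          ((A₁ + (Real.log 4 + 4)) * (1 + Real.log N))
        + 8 * N₀ * L * h * ((A₁ + (Real.log 4 + 4)) * N)
        + 8 * N₀ * L * h * M *
          ((2 * T₀ + 3 * (A₁ + (Real.log 4 + 4))) * L + (T₀ + (A₁ + (Real.log 4 + 4)))) := by
  have hN₀ : 0 ≤ N₀ := (abs_nonneg _).trans (h0 0)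
  have hN₁ : 0 ≤ N₁ := (abs_nonneg _).trans (h1 0)
  have hN₂ : 0 ≤ N₂ := (abs_nonneg _).trans (h2 0)
  have hLR : (1 : ℝ) ≤ L := by exact_mod_cast hL
  have hℓR : (1 : ℝ) ≤ ℓ := by exact_mod_cast hℓ
  have hℓLR : (ℓ : ℝ) ≤ L := by exact_mod_cast hℓL
  have hℓ'R : (1 : ℝ) ≤ ℓ' := by exact_mod_cast hℓ'
  have hℓ'LR : (ℓ' : ℝ) ≤ L := by exact_mod_cast hℓ'L
  have h32 : 1 / (32 * (L : ℝ)) ≤ 1 / 32 := one_div_le_one_div_of_le (by norm_num) (by linarith)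
  have hh4 : h ≤ 1 / 4 := by linarith
  obtain ⟨hT0, hA'0⟩ := diff_consts_nonneg hT (sum_abs_sub_vonMangoldt_le hc0 hA₁)
  set AΛ : ℝ := Real.log 4 + 4 with hAΛ
  set A' : ℝ := A₁ + AΛ with hA'
  -- notation
  set V : ℕ → ℝ := fun n ↦ ∑ k' ∈ Finset.Icc 1 M,
    (∑ k ∈ Finset.Icc 1 M, B ((Real.log ((n : ℝ) * ℓ' * k' / ℓ) - Real.log k) / h) / Real.sqrt k)
      / Real.sqrt k' / Real.sqrt n with hV
  set D : ℕ → ℝ := fun n ↦ ∑ k' ∈ Finset.Icc 1 ⌊1 / (4 * h) / ((n : ℝ) * ℓ')⌋₊,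
    (if ℓ ∣ n * ℓ' * k' then 1 / (k' : ℝ) else 0) with hD
  set Nn : ℕ → ℝ := fun n ↦ ((min M ⌊(ℓ : ℝ) * M * Real.exp (-(2 * h)) / (ℓ' * n)⌋₊
    - ⌊1 / (4 * h) / ((n : ℝ) * ℓ')⌋₊ : ℕ) : ℝ) with hNn
  set mS : ℝ := B 0 * (Real.sqrt ℓ / Real.sqrt ℓ') with hmS
  set β : ℝ := ∫ v, B v * Real.exp (-(h * v) / 2) with hβ
  set mD : ℝ := h * β * (Real.sqrt ℓ' / Real.sqrt ℓ) with hmD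
  set Cst : ℝ := 8 * ((N₀ + 2 * N₁ + N₂) * (96 + 192 * L) * L ^ 2) * L + 64 * N₀ * L ^ 2 with hCst
  -- the two weighted evaluations
  have hΛ0 : ∀ n, (0 : ℝ) ≤ Λ n := fun n ↦ ArithmeticFunction.vonMangoldt_nonneg
  have hAΛ' : ∀ N : ℕ, 1 ≤ N → ∑ n ∈ Finset.Icc 1 N, (Λ n : ℝ) ≤ AΛ * N :=
    fun N _ ↦ Montgomery.sum_Icc_vonMangoldt_le N
  have hc := weighted_node_pair (f := c) hB hB' h0 h1 h2 hBs hB0 hL hℓ hℓL hℓ' hℓ'L hh hhL hhM hhM2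
    hc0 hA₁ hN
  have hΛ := weighted_node_pair (f := fun n ↦ (Λ n : ℝ)) hB hB' h0 h1 h2 hBs hB0 hL hℓ hℓL hℓ' hℓ'L
    hh hhL hhM hhM2 hΛ0 hAΛ' hN
  -- the smooth main terms against `c - Λ`
  obtain ⟨hK₀K₁, -, -, hYM⟩ := node_ranges (M := M) hℓ hℓ' hN hh hh4 hhM
  set X₁ : ℝ := (ℓ : ℝ) * M * Real.exp (-(2 * h)) / ℓ' with hX₁
  set X₂ : ℝ := 1 / (4 * h) / ℓ' with hX₂
  have hX₁0 : 0 ≤ X₁ := by positivity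
  have hX₂0 : 0 ≤ X₂ := by positivity
  have hM1 : 1 ≤ M := by
    have : (0 : ℝ) < M := by
      by_contra hcon; push Not at hcon
      have : h * M ≤ 0 := mul_nonpos_of_nonneg_of_nonpos hh.le hcon
      linarith
    exact_mod_cast this
  have hNn_eq : ∀ n : ℕ, 1 ≤ n → Nn n = ((min M ⌊X₁ / n⌋₊ : ℕ) : ℝ) - (⌊X₂ / n⌋₊ : ℝ) := by
    intro n hn
    have hn0 : (0 : ℝ) < n := by exact_mod_cast hn
    have e1 : (ℓ : ℝ) * M * Real.exp (-(2 * h)) / (ℓ' * n) = X₁ / n := by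
      rw [hX₁, div_div]
    have e2 : 1 / (4 * h) / ((n : ℝ) * ℓ') = X₂ / n := by
      rw [hX₂, div_div (1 / (4 * h)) (ℓ' : ℝ) n, mul_comm (ℓ' : ℝ) n]
    obtain ⟨hle, -, -, -⟩ := node_ranges (M := M) hℓ hℓ' hn hh hh4 hhM
    simp only [hNn]
    rw [Nat.cast_sub hle, e1, e2]
  have hsmooth : |∑ n ∈ Finset.Icc 1 N, (c n - Λ n) * Nn n| ≤ (2 * T₀ + 3 * A') * X₁ + (T₀ + A') * X₂ := by
    have hsplit : ∑ n ∈ Finset.Icc 1 N, (c n - Λ n) * Nn n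
        = ∑ n ∈ Finset.Icc 1 N, (c n - Λ n) * ((min M ⌊X₁ / n⌋₊ : ℕ) : ℝ)
          - ∑ n ∈ Finset.Icc 1 N, (c n - Λ n) * (⌊X₂ / n⌋₊ : ℝ) := by
      rw [← Finset.sum_sub_distrib]
      refine Finset.sum_congr rfl fun n hn ↦ ?_
      rw [hNn_eq n (Finset.mem_Icc.1 hn).1]; ring
    rw [hsplit]
    have b1 := abs_sum_mul_min_floor_le hT (sum_abs_sub_vonMangoldt_le hc0 hA₁) hX₁0 hM1 N
    have b2 := abs_sum_mul_floor_div_le hT (sum_abs_sub_vonMangoldt_le hc0 hA₁) hX₂0 N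
    exact (abs_sub _ _).trans (add_le_add b1 b2)
  have hX₁le : X₁ ≤ L * M := by
    rw [hX₁, div_le_iff₀ (by positivity)]
    have he : Real.exp (-(2 * h)) ≤ 1 := Real.exp_le_one_iff.2 (by linarith)
    have hM0 : (0 : ℝ) ≤ M := Nat.cast_nonneg M
    calc (ℓ : ℝ) * M * Real.exp (-(2 * h)) ≤ L * M * 1 :=
          mul_le_mul (mul_le_mul_of_nonneg_right hℓLR hM0) he (Real.exp_pos _).le (by positivity)
      _ ≤ L * M * ℓ' := mul_le_mul_of_nonneg_left hℓ'R (by positivity)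
  have hX₂le : X₂ ≤ M := by
    rw [hX₂]
    calc 1 / (4 * h) / ℓ' ≤ 1 / (4 * h) := div_le_self (by positivity) hℓ'R
      _ ≤ M := hYM
  have hβ0 : 0 ≤ β := toothBeta_nonneg hB0 h
  have hβ8 : β ≤ 8 * N₀ := toothBeta_le hB0 h0 hBs hh.le hh4
  have hratio : Real.sqrt ℓ' / Real.sqrt ℓ ≤ L := by
    have h1' : Real.sqrt (ℓ' : ℝ) ≤ L := by rw [Real.sqrt_le_left (by linarith)]; nlinarith
    have h2' : 1 ≤ Real.sqrt (ℓ : ℝ) := by rw [Real.le_sqrt' one_pos]; simpa using hℓR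
    calc Real.sqrt ℓ' / Real.sqrt ℓ ≤ Real.sqrt ℓ' / 1 :=
          div_le_div_of_nonneg_left (Real.sqrt_nonneg _) one_pos h2'
      _ ≤ L := by rw [div_one]; exact h1'
  have hmD : |mD| ≤ 8 * N₀ * L * h := by
    rw [hmD, abs_of_nonneg (by positivity)]
    calc h * β * (Real.sqrt ℓ' / Real.sqrt ℓ) ≤ h * (8 * N₀) * L := by
          apply mul_le_mul (mul_le_mul_of_nonneg_left hβ8 hh.le) hratio (by positivity) (by positivity)
      _ = 8 * N₀ * L * h := by ring
  have hsm : |mD * ∑ n ∈ Finset.Icc 1 N, (c n - Λ n) * Nn n|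
      ≤ 8 * N₀ * L * h * M * ((2 * T₀ + 3 * A') * L + (T₀ + A')) := by
    rw [abs_mul]
    have hb : (2 * T₀ + 3 * A') * X₁ + (T₀ + A') * X₂ ≤ M * ((2 * T₀ + 3 * A') * L + (T₀ + A')) := by
      have t1 : (2 * T₀ + 3 * A') * X₁ ≤ (2 * T₀ + 3 * A') * (L * M) :=
        mul_le_mul_of_nonneg_left hX₁le (by positivity)
      have t2 : (T₀ + A') * X₂ ≤ (T₀ + A') * M := mul_le_mul_of_nonneg_left hX₂le (by positivity)
      calc (2 * T₀ + 3 * A') * X₁ + (T₀ + A') * X₂ ≤ (2 * T₀ + 3 * A') * (L * M) + (T₀ + A') * M :=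
            add_le_add t1 t2
        _ = M * ((2 * T₀ + 3 * A') * L + (T₀ + A')) := by ring
    calc |mD| * |∑ n ∈ Finset.Icc 1 N, (c n - Λ n) * Nn n|
        ≤ (8 * N₀ * L * h) * (M * ((2 * T₀ + 3 * A') * L + (T₀ + A'))) :=
          mul_le_mul hmD (hsmooth.trans hb) (abs_nonneg _) (by positivity)
      _ = _ := by ring
  -- algebra: combine the two evaluations
  have hkey : ∑ n ∈ Finset.Icc 1 N, c n * V n - ∑ n ∈ Finset.Icc 1 N, (Λ n : ℝ) * V n
        - mS * ∑ n ∈ Finset.Icc 1 N, (c n - Λ n) / n * D n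
      = (∑ n ∈ Finset.Icc 1 N, c n * V n - mS * ∑ n ∈ Finset.Icc 1 N, c n * D n / n
            - mD * ∑ n ∈ Finset.Icc 1 N, c n * Nn n)
        - (∑ n ∈ Finset.Icc 1 N, (Λ n : ℝ) * V n - mS * ∑ n ∈ Finset.Icc 1 N, (Λ n : ℝ) * D n / n
            - mD * ∑ n ∈ Finset.Icc 1 N, (Λ n : ℝ) * Nn n)
        + mD * ∑ n ∈ Finset.Icc 1 N, (c n - Λ n) * Nn n := by
    have e1 : ∑ n ∈ Finset.Icc 1 N, (c n - Λ n) / n * D n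
        = ∑ n ∈ Finset.Icc 1 N, c n * D n / n - ∑ n ∈ Finset.Icc 1 N, (Λ n : ℝ) * D n / n := by
      rw [← Finset.sum_sub_distrib]; refine Finset.sum_congr rfl fun n _ ↦ by ring
    have e2 : ∑ n ∈ Finset.Icc 1 N, (c n - Λ n) * Nn n
        = ∑ n ∈ Finset.Icc 1 N, c n * Nn n - ∑ n ∈ Finset.Icc 1 N, (Λ n : ℝ) * Nn n := by
      rw [← Finset.sum_sub_distrib]; refine Finset.sum_congr rfl fun n _ ↦ by ring
    rw [e1, e2]; ring
  rw [hkey]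
  calc |(∑ n ∈ Finset.Icc 1 N, c n * V n - mS * ∑ n ∈ Finset.Icc 1 N, c n * D n / n
            - mD * ∑ n ∈ Finset.Icc 1 N, c n * Nn n)
        - (∑ n ∈ Finset.Icc 1 N, (Λ n : ℝ) * V n - mS * ∑ n ∈ Finset.Icc 1 N, (Λ n : ℝ) * D n / n
            - mD * ∑ n ∈ Finset.Icc 1 N, (Λ n : ℝ) * Nn n)
        + mD * ∑ n ∈ Finset.Icc 1 N, (c n - Λ n) * Nn n|
      ≤ |∑ n ∈ Finset.Icc 1 N, c n * V n - mS * ∑ n ∈ Finset.Icc 1 N, c n * D n / n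
            - mD * ∑ n ∈ Finset.Icc 1 N, c n * Nn n|
        + |∑ n ∈ Finset.Icc 1 N, (Λ n : ℝ) * V n - mS * ∑ n ∈ Finset.Icc 1 N, (Λ n : ℝ) * D n / n
            - mD * ∑ n ∈ Finset.Icc 1 N, (Λ n : ℝ) * Nn n|
        + |mD * ∑ n ∈ Finset.Icc 1 N, (c n - Λ n) * Nn n| :=
        (abs_add_le _ _).trans (add_le_add (abs_sub _ _) le_rfl)
    _ ≤ (Cst * (A₁ * (1 + Real.log N)) + 8 * N₀ * L * h * (A₁ * N))
        + (Cst * (AΛ * (1 + Real.log N)) + 8 * N₀ * L * h * (AΛ * N))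
        + 8 * N₀ * L * h * M * ((2 * T₀ + 3 * A') * L + (T₀ + A')) :=
        add_le_add (add_le_add hc hΛ) hsm
    _ = Cst * ((A₁ + AΛ) * (1 + Real.log N)) + 8 * N₀ * L * h * ((A₁ + AΛ) * N)
        + 8 * N₀ * L * h * M * ((2 * T₀ + 3 * A') * L + (T₀ + A')) := by ring

end Literature.NumberTheory.LFunctions
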